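import Mathlib
import HarnessLib
import Summits.Parity.BatemanHorn.Statement
import Summits.Parity.BatemanHorn.Theses.SelbergLift
import Literature.NumberTheory.Sieve.BatemanHornProofs

/-!
# Birth skeleton for the crux `DerivedFamilyMid` (route SelbergLift, item stmt-Parity-18413)

Line `birth`: the middle-range pair sum `Mid_ε(x)` of the crux is, up to an elementary error,
twice the sum over the SMALLER factor restricted to PRIMES `p` (`stub_smallerPrimeReduction`:
symmetry `a ↔ f_i(n)/a`, the diagonal `f_i(n) = a²` and prime-power smaller factors `p^r`,
`r ≥ 2`, are `o(x log x)`); the prime-indexed sum is Bateman–Horn on average over the `p`-derived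
family `(f_i(ν + pX)/p, f_j(ν + pX))`, and it is cut at `p = x^{1/2}` into the two regimes that
own different tools:

* `stub_derivedFamilyLowerHalf` — moduli `x^ε < p ≤ x^{1/2}` (each derived polynomial is sampled
  on a range `x/p ≥ p` at least as long as its modulus; dispersion / large-sieve range, share
  `(1/2 − ε)·C(f)`);
* `stub_derivedFamilyUpperHalf` — moduli `x^{1/2} < p ≤ x^{1−ε}` (ranges `x/p < p` shorter than
  the modulus, only the `(p, ν)`-average is meaningful; Kloosterman / beyond-`1/2` range, share
  `(min(1−ε, deg f_i/2) − 1/2)·C(f)`, which is `0` for a linear member: then the stub is an upper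
  bound `O(x)`).

`DerivedFamilyMid_of : SelbergLift.DerivedFamilyMid` concludes the crux BY NAME from the three stubs by name;
its sorry-free core `mid_isEquivalent_of_halves` (and the hypothesis-form `example`
`stub₁-sig → stub₂-sig → stub₃-sig → DerivedFamilyMid`) is the kernel-checked composition: the two
half-range sums partition the
prime-indexed sum pointwise (`pairSum_split`, needs only `x^{1/2} ≤ x^{1−ε}` for `x ≥ 1`), the
shares add up to `min(1−ε, deg f_i/2) − ε`, and `o(x log x)` is `o` of the main term because
`2(min(1−ε, deg f_i/2) − ε)·C(f) > 0` (`ε < 1/4`, `deg f_i ≥ 1` by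
`IsBatemanHornSystem.natDegree_pos`, `C(f) > 0` by `IsBatemanHornSystem.hasBatemanHornConst_holds`).
Sorries live ONLY in the three `stub_*` theorems.
-/

namespace Summit.Parity.BatemanHorn.Cruxes.DerivedFamilyMid.Birth

open scoped BigOperators Topology Classical
open Filter Asymptotics

/-- stub (size L, provable now): reduction of the middle-range pair sum to twice the sum over the
smaller factor restricted to primes. `Mid_ε(x) − 2·P_ε(x)` consists of the diagonal terms
`f_i(n) = a²` (at most `deg f_i` values of `n` per `a ≤ x^(1−ε)`) and twice the terms whose smaller
factor is a prime power `p^r`, `r ≥ 2`, `p^r > x^ε` (root-class count `≪ x·ρ_i(p^r)/p^r + ρ_i(p^r)`),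
both `≪ x^(1−ε/2+o(1))`; for a prime smaller factor `Λ(p) = log p` and `a < f_i(n)/a ↔ a·a < f_i(n)`. -/
theorem stub_smallerPrimeReduction :
    ∀ (k : ℕ) (f : Fin k → Polynomial ℤ) (i : Fin k), Literature.NumberTheory.Sieve.IsBatemanHornSystem f → ∀ ε : ℝ, 0 < ε → ε < 1 / 4 → (fun x : ℕ => (∑ n ∈ Finset.Icc 1 x, (∑ a ∈ (((f i).eval (n : ℤ)).toNat).divisors, if (x : ℝ) ^ ε < ((min a ((((f i).eval (n : ℤ)).toNat) / a) : ℕ) : ℝ) ∧ ((min a ((((f i).eval (n : ℤ)).toNat) / a) : ℕ) : ℝ) ≤ (x : ℝ) ^ (1 - ε) then ArithmeticFunction.vonMangoldt a * ArithmeticFunction.vonMangoldt ((((f i).eval (n : ℤ)).toNat) / a) else 0) * ∏ j ∈ Finset.univ.erase i, ArithmeticFunction.vonMangoldt (((f j).eval (n : ℤ)).toNat)) - 2 * (∑ n ∈ Finset.Icc 1 x, (∑ p ∈ (((f i).eval (n : ℤ)).toNat).divisors, if p.Prime ∧ (x : ℝ) ^ ε < (p : ℝ) ∧ (p : ℝ)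 ≤ (x : ℝ) ^ (1 - ε) ∧ p * p < (((f i).eval (n : ℤ)).toNat) then Real.log p * ArithmeticFunction.vonMangoldt ((((f i).eval (n : ℤ)).toNat) / p) else 0) * ∏ j ∈ Finset.univ.erase i, ArithmeticFunction.vonMangoldt (((f j).eval (n : ℤ)).toNat))) =o[Filter.atTop] (fun x : ℕ => (x : ℝ) * Real.log x) := by
  sorry

/-- stub (the hardest; open, parity-carrying): Bateman–Horn on average over the `p`-derived family in
the LOWER half-range `x^ε < p ≤ x^(1/2)`: grouping `n = ν + p·m` (`f_i(ν) ≡ 0 mod p`) the sum is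
`Σ_p log p Σ_ν Σ_(m ≤ x/p) Λ(f_i(ν+pm)/p) ∏_(j≠i) Λ(f_j(ν+pm))` with ranges `x/p ≥ p`; its share of
the pair density `C(f)·x log x dα` (`α = log p/log x ∈ (ε, 1/2]`) is `1/2 − ε` for every degree
(the constraint `p² < f_i(n)` and the boundary cost `O(x)`). For a linear system this is the weighted
Chen count `q − h = p·m` on average — two-sided bounds are classical, the asymptotic is open. -/
theorem stub_derivedFamilyLowerHalf :
    ∀ (k : ℕ) (f : Fin k → Polynomial ℤ) (i : Fin k), Literature.NumberTheory.Sieve.IsBatemanHornSystem f → ∀ ε : ℝ, 0 < ε → ε < 1 / 4 → (fun x : ℕ => (∑ n ∈ Finset.Icc 1 x, (∑ p ∈ (((f i).eval (n : ℤ)).toNat).divisors, if p.Prime ∧ (x : ℝ) ^ ε < (p : ℝ) ∧ (p : ℝ) ≤ (x : ℝ) ^ ((1 : ℝ) / 2) ∧ p * p < (((f i).eval (n : ℤ)).toNat) then Real.log p * ArithmeticFunction.vonMangoldt ((((f i).eval (n : ℤ)).toNat) / p) else 0) * ∏ j ∈ Finset.univ.erase i, ArithmeticFunction.vonMangoldt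 (((f j).eval (n : ℤ)).toNat)) - (1 / 2 - ε) * Literature.NumberTheory.Sieve.batemanHornConst f * (x : ℝ) * Real.log x) =o[Filter.atTop] (fun x : ℕ => (x : ℝ) * Real.log x) := by
  sorry

/-- stub (open for `deg f_i ≥ 2`, an upper-bound sieve estimate for `deg f_i = 1`): the UPPER
half-range `x^(1/2) < p ≤ x^(1−ε)` of the prime-indexed pair sum, where each derived polynomial
`f_i(ν+pX)/p` is sampled on fewer than `p` values and only the average over `(p, ν)` can hold; share
`min(1−ε, deg f_i/2) − 1/2` of `C(f)·x log x` (`= 1/2 − ε` when `deg f_i ≥ 2`; `= 0` when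
`deg f_i = 1`, where `p² < f_i(n) ≪ x` confines `p` to `(x^(1/2), (c·x)^(1/2)]` and the sum is `O(x)`). -/
theorem stub_derivedFamilyUpperHalf :
    ∀ (k : ℕ) (f : Fin k → Polynomial ℤ) (i : Fin k), Literature.NumberTheory.Sieve.IsBatemanHornSystem f → ∀ ε : ℝ, 0 < ε → ε < 1 / 4 → (fun x : ℕ => (∑ n ∈ Finset.Icc 1 x, (∑ p ∈ (((f i).eval (n : ℤ)).toNat).divisors, if p.Prime ∧ (x : ℝ) ^ ((1 : ℝ) / 2) < (p : ℝ) ∧ (p : ℝ) ≤ (x : ℝ) ^ (1 - ε) ∧ p * p < (((f i).eval (n : ℤ)).toNat) then Real.log p * ArithmeticFunction.vonMangoldt ((((f i).eval (n : ℤ)).toNat) / p) else 0) * ∏ j ∈ Finset.univ.erase i, ArithmeticFunction.vonMangoldt (((f j).eval (n : ℤ)).toNat)) - (min (1 - ε) (((f i).natDegree : ℝ) / 2) - 1 / 2) * Literature.NumberTheory.Sieve.batemanHornConst f * (x : ℝ) * Real.log x) =o[Filter.atTop] (fun x : ℕ => (x : ℝ) * Real.log x) := by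
  sorry

/-- Propositional bookkeeping for `pairSum_split`: a four-fold conjunction cut by a dichotomy
`C ∨ D` (`D ↔ ¬C`) in its two middle slots. The `Decidable` instances are taken from the goal. -/
theorem ite_and_split {α : Type*} [AddZeroClass α] {P A B C D S : Prop}
    {_i₁ : Decidable (P ∧ A ∧ B ∧ S)} {_i₂ : Decidable (P ∧ A ∧ C ∧ S)}
    {_i₃ : Decidable (P ∧ D ∧ B ∧ S)} (hCB : C → B) (hDA : D → A) (hD : D ↔ ¬ C) (t : α) :
    (if P ∧ A ∧ B ∧ S then t else 0) =
      (if P ∧ A ∧ C ∧ S then t else 0) + (if P ∧ D ∧ B ∧ S then t else 0) := by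
  by_cases hc : C
  · have hnd : ¬ D := fun hd => (hD.mp hd) hc
    by_cases h : P ∧ A ∧ B ∧ S
    · rw [if_pos h, if_pos ⟨h.1, h.2.1, hc, h.2.2.2⟩, if_neg (fun h' => hnd h'.2.1), add_zero]
    · have h₂ : ¬ (P ∧ A ∧ C ∧ S) := fun h' => h ⟨h'.1, h'.2.1, hCB hc, h'.2.2.2⟩
      rw [if_neg h, if_neg h₂, if_neg (fun h' => hnd h'.2.1), add_zero]
  · have hd : D := hD.mpr hc
    by_cases h : P ∧ A ∧ B ∧ S
    · rw [if_pos h, if_neg (fun h' => hc h'.2.2.1), if_pos ⟨h.1, hd, h.2.2.1, h.2.2.2⟩, zero_add]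
    · have h₃ : ¬ (P ∧ D ∧ B ∧ S) := fun h' => h ⟨h'.1, hDA h'.2.1, h'.2.2.1, h'.2.2.2⟩
      rw [if_neg h, if_neg (fun h' => hc h'.2.2.1), if_neg h₃, add_zero]

/-- Pointwise partition of the prime-indexed pair sum at `p = x^(1/2)` (pure bookkeeping: for
`x ≥ 1` and `ε ≤ 1/2`, `x^ε ≤ x^(1/2) ≤ x^(1−ε)`). -/
theorem pairSum_split (k : ℕ) (f : Fin k → Polynomial ℤ) (i : Fin k) (ε : ℝ) (hε : ε < 1 / 4)
    (x : ℕ) (hx : 1 ≤ x) :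
    (∑ n ∈ Finset.Icc 1 x, (∑ p ∈ (((f i).eval (n : ℤ)).toNat).divisors, if p.Prime ∧ (x : ℝ) ^ ε < (p : ℝ) ∧ (p : ℝ) ≤ (x : ℝ) ^ (1 - ε) ∧ p * p < (((f i).eval (n : ℤ)).toNat) then Real.log p * ArithmeticFunction.vonMangoldt ((((f i).eval (n : ℤ)).toNat) / p) else 0) * ∏ j ∈ Finset.univ.erase i, ArithmeticFunction.vonMangoldt (((f j).eval (n : ℤ)).toNat)) = (∑ n ∈ Finset.Icc 1 x, (∑ p ∈ (((f i).eval (n : ℤ)).toNat).divisors, if p.Prime ∧ (x : ℝ) ^ ε < (p : ℝ) ∧ (p : ℝ) ≤ (x : ℝ) ^ ((1 : ℝ) / 2) ∧ p * p < (((f i).eval (n : ℤ)).toNat) then Real.log p * ArithmeticFunction.vonMangoldt ((((f i).eval (n : ℤ)).toNat) / p) else 0) * ∏ j ∈ Finset.univ.erase i, ArithmeticFunction.vonMangoldt (((f j).eval (n : ℤ)).toNat)) + (∑ n ∈ Finset.Icc 1 x, (∑ p ∈ (((f i).eval (n : ℤ)).toNat).divisors, if p.Prime ∧ (x : ℝ)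 ^ ((1 : ℝ) / 2) < (p : ℝ) ∧ (p : ℝ) ≤ (x : ℝ) ^ (1 - ε) ∧ p * p < (((f i).eval (n : ℤ)).toNat) then Real.log p * ArithmeticFunction.vonMangoldt ((((f i).eval (n : ℤ)).toNat) / p) else 0) * ∏ j ∈ Finset.univ.erase i, ArithmeticFunction.vonMangoldt (((f j).eval (n : ℤ)).toNat)) := by
  have hx' : (1 : ℝ) ≤ (x : ℝ) := by exact_mod_cast hx
  have hmono : (x : ℝ) ^ ((1 : ℝ) / 2) ≤ (x : ℝ) ^ (1 - ε) :=
    Real.rpow_le_rpow_of_exponent_le hx' (by linarith)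
  have hmono' : (x : ℝ) ^ ε ≤ (x : ℝ) ^ ((1 : ℝ) / 2) :=
    Real.rpow_le_rpow_of_exponent_le hx' (by linarith)
  rw [← Finset.sum_add_distrib]
  refine Finset.sum_congr rfl fun n _ => ?_
  rw [← add_mul]
  congr 1
  rw [← Finset.sum_add_distrib]
  refine Finset.sum_congr rfl fun p _ => ?_
  exact ite_and_split (fun h => h.trans hmono) (fun h => lt_of_le_of_lt hmono' h)
    (not_le (a := (p : ℝ)) (b := (x : ℝ) ^ ((1 : ℝ) / 2))).symm _

/-! ### Assembly -/

/-- Per-system core of the composition (sorry-free): for a fixed Bateman–Horn system `f`, index `i`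
and `0 < ε < 1/4`, the three stub conclusions AT `(f, i, ε)` give the crux's asymptotic equivalence
at `(f, i, ε)`. Pointwise partition `pairSum_split`, shares `2(1/2 − ε) + 2(min − 1/2) = 2(min − ε)`
(`ring`), and `o(x log x) = o(main term)` since `2(min(1−ε, deg f_i/2) − ε)·C(f) ≠ 0`. -/
theorem mid_isEquivalent_of_halves (k : ℕ) (f : Fin k → Polynomial ℤ) (i : Fin k)
    (hf : Literature.NumberTheory.Sieve.IsBatemanHornSystem f) (ε : ℝ) (hε : 0 < ε) (hε4 : ε < 1 / 4)
    (hA' : (fun x : ℕ => (∑ n ∈ Finset.Icc 1 x, (∑ a ∈ (((f i).eval (n : ℤ)).toNat).divisors, if (x : ℝ) ^ ε < ((min a ((((f i).eval (n : ℤ)).toNat) / a) : ℕ) : ℝ) ∧ ((min a ((((f i).eval (n : ℤ)).toNat) / a) : ℕ) : ℝ) ≤ (x : ℝ) ^ (1 - ε) then ArithmeticFunction.vonMangoldt a * ArithmeticFunction.vonMangoldt ((((f i).eval (n : ℤ)).toNat) / a) else 0) * ∏ j ∈ Finset.univ.erase i, ArithmeticFunction.vonMangoldt (((f j).eval (n :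 ℤ)).toNat)) - 2 * (∑ n ∈ Finset.Icc 1 x, (∑ p ∈ (((f i).eval (n : ℤ)).toNat).divisors, if p.Prime ∧ (x : ℝ) ^ ε < (p : ℝ) ∧ (p : ℝ) ≤ (x : ℝ) ^ (1 - ε) ∧ p * p < (((f i).eval (n : ℤ)).toNat) then Real.log p * ArithmeticFunction.vonMangoldt ((((f i).eval (n : ℤ)).toNat) / p) else 0) * ∏ j ∈ Finset.univ.erase i, ArithmeticFunction.vonMangoldt (((f j).eval (n : ℤ)).toNat))) =o[Filter.atTop] (fun x : ℕ => (x : ℝ) * Real.log x))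
    (hB' : (fun x : ℕ => (∑ n ∈ Finset.Icc 1 x, (∑ p ∈ (((f i).eval (n : ℤ)).toNat).divisors, if p.Prime ∧ (x : ℝ) ^ ε < (p : ℝ) ∧ (p : ℝ) ≤ (x : ℝ) ^ ((1 : ℝ) / 2) ∧ p * p < (((f i).eval (n : ℤ)).toNat) then Real.log p * ArithmeticFunction.vonMangoldt ((((f i).eval (n : ℤ)).toNat) / p) else 0) * ∏ j ∈ Finset.univ.erase i, ArithmeticFunction.vonMangoldt (((f j).eval (n : ℤ)).toNat)) - (1 / 2 - ε) * Literature.NumberTheory.Sieve.batemanHornConst f * (x : ℝ) * Real.log x) =o[Filter.atTop] (fun x : ℕ => (x : ℝ) * Real.log x))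
    (hC' : (fun x : ℕ => (∑ n ∈ Finset.Icc 1 x, (∑ p ∈ (((f i).eval (n : ℤ)).toNat).divisors, if p.Prime ∧ (x : ℝ) ^ ((1 : ℝ) / 2) < (p : ℝ) ∧ (p : ℝ) ≤ (x : ℝ) ^ (1 - ε) ∧ p * p < (((f i).eval (n : ℤ)).toNat) then Real.log p * ArithmeticFunction.vonMangoldt ((((f i).eval (n : ℤ)).toNat) / p) else 0) * ∏ j ∈ Finset.univ.erase i, ArithmeticFunction.vonMangoldt (((f j).eval (n : ℤ)).toNat)) - (min (1 - ε) (((f i).natDegree : ℝ) / 2) - 1 / 2) * Literature.NumberTheory.Sieve.batemanHornConst f * (x : ℝ) * Real.log x) =o[Filter.atTop] (fun x : ℕ => (x : ℝ) * Real.log x)) :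
    Asymptotics.IsEquivalent Filter.atTop (fun x : ℕ => ∑ n ∈ Finset.Icc 1 x, (∑ a ∈ (((f i).eval (n : ℤ)).toNat).divisors, if (x : ℝ) ^ ε < ((min a ((((f i).eval (n : ℤ)).toNat) / a) : ℕ) : ℝ) ∧ ((min a ((((f i).eval (n : ℤ)).toNat) / a) : ℕ) : ℝ) ≤ (x : ℝ) ^ (1 - ε) then ArithmeticFunction.vonMangoldt a * ArithmeticFunction.vonMangoldt ((((f i).eval (n : ℤ)).toNat) / a) else 0) * ∏ j ∈ Finset.univ.erase i, ArithmeticFunction.vonMangoldt (((f j).eval (n : ℤ)).toNat)) (fun x : ℕ => 2 * (min (1 - ε) (((f i).natDegree : ℝ) / 2) - ε) * Literature.NumberTheory.Sieve.batemanHornConst f * (x : ℝ) * Real.log x) := by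
  -- positivity of the main-term constant
  have hCpos : 0 < Literature.NumberTheory.Sieve.batemanHornConst f :=
    (Literature.NumberTheory.Sieve.IsBatemanHornSystem.hasBatemanHornConst_holds hf).2
  have hd : (1 : ℝ) ≤ ((f i).natDegree : ℝ) := by
    exact_mod_cast Literature.NumberTheory.Sieve.IsBatemanHornSystem.natDegree_pos hf i
  have hmin : ε < min (1 - ε) (((f i).natDegree : ℝ) / 2) := lt_min (by linarith) (by linarith)
  have hK : 2 * (min (1 - ε) (((f i).natDegree : ℝ) / 2) - ε) * Literature.NumberTheory.Sieve.batemanHornConst f ≠ 0 :=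
    (mul_pos (mul_pos two_pos (sub_pos.mpr hmin)) hCpos).ne'
  -- the combined little-o statement for the crux's own difference
  have key : (fun x : ℕ => (∑ n ∈ Finset.Icc 1 x, (∑ a ∈ (((f i).eval (n : ℤ)).toNat).divisors, if (x : ℝ) ^ ε < ((min a ((((f i).eval (n : ℤ)).toNat) / a) : ℕ) : ℝ) ∧ ((min a ((((f i).eval (n : ℤ)).toNat) / a) : ℕ) : ℝ) ≤ (x : ℝ) ^ (1 - ε) then ArithmeticFunction.vonMangoldt a * ArithmeticFunction.vonMangoldt ((((f i).eval (n : ℤ)).toNat) / a) else 0) * ∏ j ∈ Finset.univ.erase i, ArithmeticFunction.vonMangoldt (((f j).eval (n : ℤ)).toNat)) - 2 * (min (1 - ε) (((f i).natDegree : ℝ) / 2) - ε) * Literature.NumberTheory.Sieve.batemanHornConst f * (x : ℝ) * Real.log x) =o[Filter.atTop] (fun x : ℕ => (x : ℝ) * Real.log x) := by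
    have hsum := hA'.add ((hB'.const_mul_left 2).add (hC'.const_mul_left 2))
    refine hsum.congr' ?_ Filter.EventuallyEq.rfl
    filter_upwards [Filter.eventually_ge_atTop 1] with x hx
    rw [pairSum_split k f i ε hε4 x hx]
    ring
  have hv : (fun x : ℕ => (x : ℝ) * Real.log x) =O[Filter.atTop] (fun x : ℕ => 2 * (min (1 - ε) (((f i).natDegree : ℝ) / 2) - ε) * Literature.NumberTheory.Sieve.batemanHornConst f * (x : ℝ) * Real.log x) := by
    refine (Asymptotics.isBigO_self_const_mul hK (fun x : ℕ => (x : ℝ) * Real.log x) Filter.atTop).congr_right ?_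
    intro x
    ring
  exact key.trans_isBigO hv

/-- ASSEMBLY IN HYPOTHESIS FORM (kernel-checked, sorry-free; an `example`, because the native skeleton
audit `#h21_check_skeleton` admits as hypotheses of a crux-concluding THEOREM only named obligations):
`stub_smallerPrimeReduction-sig → stub_derivedFamilyLowerHalf-sig → stub_derivedFamilyUpperHalf-sig →
SelbergLift.DerivedFamilyMid`. -/
example :
    (∀ (k : ℕ) (f : Fin k → Polynomial ℤ) (i : Fin k), Literature.NumberTheory.Sieve.IsBatemanHornSystem f → ∀ ε : ℝ, 0 < ε → ε < 1 / 4 → (fun x : ℕ => (∑ n ∈ Finset.Icc 1 x, (∑ a ∈ (((f i).eval (n : ℤ)).toNat).divisors, if (x : ℝ) ^ ε < ((min a ((((f i).eval (n : ℤ)).toNat) / a) : ℕ) : ℝ) ∧ ((min a ((((f i).eval (n : ℤ)).toNat) / a) : ℕ) : ℝ) ≤ (x : ℝ) ^ (1 - ε) then ArithmeticFunction.vonMangoldt a * ArithmeticFunction.vonMangoldt ((((f i).eval (n : ℤ)).toNat) / a) else 0) * ∏ j ∈ Finset.univ.erase i, ArithmeticFunction.vonMangoldt (((f j).eval (n : ℤ)).toNat))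 - 2 * (∑ n ∈ Finset.Icc 1 x, (∑ p ∈ (((f i).eval (n : ℤ)).toNat).divisors, if p.Prime ∧ (x : ℝ) ^ ε < (p : ℝ) ∧ (p : ℝ) ≤ (x : ℝ) ^ (1 - ε) ∧ p * p < (((f i).eval (n : ℤ)).toNat) then Real.log p * ArithmeticFunction.vonMangoldt ((((f i).eval (n : ℤ)).toNat) / p) else 0) * ∏ j ∈ Finset.univ.erase i, ArithmeticFunction.vonMangoldt (((f j).eval (n : ℤ)).toNat))) =o[Filter.atTop] (fun x : ℕ => (x : ℝ) * Real.log x)) →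
    (∀ (k : ℕ) (f : Fin k → Polynomial ℤ) (i : Fin k), Literature.NumberTheory.Sieve.IsBatemanHornSystem f → ∀ ε : ℝ, 0 < ε → ε < 1 / 4 → (fun x : ℕ => (∑ n ∈ Finset.Icc 1 x, (∑ p ∈ (((f i).eval (n : ℤ)).toNat).divisors, if p.Prime ∧ (x : ℝ) ^ ε < (p : ℝ) ∧ (p : ℝ) ≤ (x : ℝ) ^ ((1 : ℝ) / 2) ∧ p * p < (((f i).eval (n : ℤ)).toNat) then Real.log p * ArithmeticFunction.vonMangoldt ((((f i).eval (n : ℤ)).toNat) / p) else 0) * ∏ j ∈ Finset.univ.erase i, ArithmeticFunction.vonMangoldt (((f j).eval (n : ℤ)).toNat)) - (1 / 2 - ε) * Literature.NumberTheory.Sieve.batemanHornConst f * (x : ℝ) * Real.log x) =o[Filter.atTop] (fun x : ℕ => (x : ℝ) * Real.log x)) →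
    (∀ (k : ℕ) (f : Fin k → Polynomial ℤ) (i : Fin k), Literature.NumberTheory.Sieve.IsBatemanHornSystem f → ∀ ε : ℝ, 0 < ε → ε < 1 / 4 → (fun x : ℕ => (∑ n ∈ Finset.Icc 1 x, (∑ p ∈ (((f i).eval (n : ℤ)).toNat).divisors, if p.Prime ∧ (x : ℝ) ^ ((1 : ℝ) / 2) < (p : ℝ) ∧ (p : ℝ) ≤ (x : ℝ) ^ (1 - ε) ∧ p * p < (((f i).eval (n : ℤ)).toNat) then Real.log p * ArithmeticFunction.vonMangoldt ((((f i).eval (n : ℤ)).toNat) / p) else 0) * ∏ j ∈ Finset.univ.erase i, ArithmeticFunction.vonMangoldt (((f j).eval (n : ℤ)).toNat)) - (min (1 - ε) (((f i).natDegree : ℝ) / 2) - 1 / 2) * Literature.NumberTheory.Sieve.batemanHornConst f * (x : ℝ) * Real.log x) =o[Filter.atTop] (fun x : ℕ => (x : ℝ) * Real.log x)) →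
    Summit.Parity.BatemanHorn.Theses.SelbergLift.DerivedFamilyMid :=
  fun hA hB hC k f i hf ε hε hε4 =>
    mid_isEquivalent_of_halves k f i hf ε hε hε4 (hA k f i hf ε hε hε4) (hB k f i hf ε hε hε4)
      (hC k f i hf ε hε hε4)

/-- THE SKELETON THEOREM: the crux `SelbergLift.DerivedFamilyMid`, concluded BY NAME from the three
registered stubs plugged in by name (no `sorry` here; `#print axioms` today = the stubs' `sorryAx` plus
propext / Classical.choice / Quot.sound; it becomes the crux proof when the stubs are discharged). -/
theorem DerivedFamilyMid_of : Summit.Parity.BatemanHorn.Theses.SelbergLift.DerivedFamilyMid :=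
  fun k f i hf ε hε hε4 =>
    mid_isEquivalent_of_halves k f i hf ε hε hε4 (stub_smallerPrimeReduction k f i hf ε hε hε4)
      (stub_derivedFamilyLowerHalf k f i hf ε hε hε4) (stub_derivedFamilyUpperHalf k f i hf ε hε hε4)

end Summit.Parity.BatemanHorn.Cruxes.DerivedFamilyMid.Birth
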